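import Summits.AtomisticToContinuum.Crystallization.Theorems.FrustratedLawDichotomyStrainedPatchHomLeafTableCheckHcp

/-!
# hcp table leaf, SCALED-FRAME VECTOR FORM `leafCheckV` (the hcp P-twin of hand-1's param-form leaf; critic rows 887 / 891 / 893)

decomp-a2c hand-2 g25 (crux `AperiodicFrustratedLawGap`, stmt-AtomisticToContinuum-27623).  DEFINITIONS ONLY (computable; no instances, no notation,
no `#eval`).  The v2 hcp leaf `…CheckHcp.leafCheckH` works on a box of the ten extended-Gram CLASSES and pays the first-order penalty class-wise; the
hcp critical layer (centre `u6` of census row 893) then needs entry half-width `2⁻¹⁵`.  This leaf works directly on the twelve ENTRY/SHUFFLE parameters.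

THE SCALED FRAME.  A point of either hcp family is `U (p_b + u (s + ξ))` (`p_b = Σ bᵢ fᵢ`, `f = hexFrame`, `s = hcpShift`, family bit `u ∈ {0, 1}`), and
`p_b + u s = S e` with the diagonal `S = diag(κ)`, `κ = (1/2, 1/(2√3), √(2/3))` and the INTEGER vector `e = (2b₀ + b₁ + u, 3b₁ + u, 2b₂ + u)`.  Hence the
point is `V z` with `V := U S` and `z := e + u η`, `η := S⁻¹ ξ`.  A leaf is a box `|V − V̂| ≤ Ŵ` (nine entries), `|η − η̂| ≤ Ŵη` (three), all at scale
`SC`; the irrational `κ` only enter the per-leaf conversion `(U, ξ)`-box ↦ `(V, η)`-box (companion entry module), never the per-label loop.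

PER LABEL (all integer): `Z = SC·e + u·η̂` (scale `SC`), `P = V̂ Z` (scale `SC²`), centre value `Q = ⌊‖P‖² / SC³⌋`, deviation bound
`D_a = Σ_c Ŵ_ac |Z_c| + u Σ_c |V̂_ac| Ŵη_c + u Σ_c Ŵ_ac Ŵη_c` (scale `SC²`; `|(V z − V̂ z⁰)_a| ≤ D_a/SC²` on the box), range radius
`R = ⌊(2 Σ_a |P_a| D_a + Σ_a D_a²) / SC³⌋ + 2` (so that `SC·‖V z‖² ∈ [Q − R, Q + R]` on the box).  The fold is hand-2's `step1H … step4H` logic on an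
accumulator with two extra fields `sa = Σ_treated aD`, `sr = Σ_treated R` (for the `E`-uncertainty and centre-flooring terms); the ten signed class
gradients `gⱼ = Σ D̂ Lⱼ`, `L = (b₀², b₁², b₂², b₀b₁, b₀b₂, b₁b₂, 2ub₀, 2ub₁, 2ub₂, u)`, are accumulated exactly as in `step4H`.

FINAL (once per leaf).  `Σ_v D̂_v (q_v − q̂⁰_v)` is a polynomial in `(V − V̂, η − η̂)` whose label dependence enters only through the moments
`Γ = Σ D̂ z⁰z⁰ᵀ`, `γ = Σ D̂ u z⁰`, `C = Σ D̂ u` — FIXED INTEGER COMBINATIONS of the ten class gradients (`2A`, `2B`, `2C` below; e.g.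
`e₀² = 4b₀² + 4b₀b₁ + b₁² + u(4b₀ + 2b₁) + u`).  First order: `|2Σ Δ_ac (V̂Γ)_ac + 2Σ δ_c (V̂ᵀV̂γ)_c| ≤ Σ|(V̂·2Γ)_ac| Ŵ_ac + Σ|(V̂ᵀV̂·2γ)_c| Ŵη_c`
(terms `T1`, `T2`); second order `T3 … T6`.  The final inequality is hand-2's `lhsH ≤ rhsH` with `G := ⌈(T1+…+T6)/SC³⌉` and the two new terms.
Float model (hand-2 g25 `model/model_hv.py`, geometric K tiers): identity-hcp passes at `2⁻⁸`, `u6` and the relaxed critical point at `2⁻⁹` (bar `2⁻¹¹`).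
Semantics / soundness: companion modules.  `--supports stmt-AtomisticToContinuum-27623`.
-/

namespace Summit.AtomisticToContinuum.Crystallization.Theorems.FrustratedLawDichotomyStrainedPatchHomLeafTableCheckHcpV

open Summit.AtomisticToContinuum.Crystallization.Theorems.FrustratedLawDichotomyStrainedPatchHomLeafTableCheck
  (Row QT SCN addP addN sx absDiff)
open Summit.AtomisticToContinuum.Crystallization.Theorems.FrustratedLawDichotomyStrainedPatchHomLeafTableCheckHcp (NH)

/-! ## §1. Per-leaf data: the scaled-frame box -/

/-- The per-leaf constants of the vector-form leaf: centre `V̂ = U₀·diag(κ)` (signed, scale `SC`), half-widths `Ŵ`, scaled shuffle centre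
`η̂ = diag(κ)⁻¹ ξ₀` (signed) and half-widths `Ŵη`, all at scale `SC`. -/
structure LV where
  /-- `SC·V̂₀₀` -/
  v00 : ℤ
  /-- `SC·V̂₀₁` -/
  v01 : ℤ
  /-- `SC·V̂₀₂` -/
  v02 : ℤ
  /-- `SC·V̂₁₀` -/
  v10 : ℤ
  /-- `SC·V̂₁₁` -/
  v11 : ℤ
  /-- `SC·V̂₁₂` -/
  v12 : ℤ
  /-- `SC·V̂₂₀` -/
  v20 : ℤ
  /-- `SC·V̂₂₁` -/
  v21 : ℤ
  /-- `SC·V̂₂₂` -/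
  v22 : ℤ
  /-- `SC·Ŵ₀₀` -/
  w00 : ℕ
  /-- `SC·Ŵ₀₁` -/
  w01 : ℕ
  /-- `SC·Ŵ₀₂` -/
  w02 : ℕ
  /-- `SC·Ŵ₁₀` -/
  w10 : ℕ
  /-- `SC·Ŵ₁₁` -/
  w11 : ℕ
  /-- `SC·Ŵ₁₂` -/
  w12 : ℕ
  /-- `SC·Ŵ₂₀` -/
  w20 : ℕ
  /-- `SC·Ŵ₂₁` -/
  w21 : ℕ
  /-- `SC·Ŵ₂₂` -/
  w22 : ℕ
  /-- `SC·η̂₀` -/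
  n0 : ℤ
  /-- `SC·η̂₁` -/
  n1 : ℤ
  /-- `SC·η̂₂` -/
  n2 : ℤ
  /-- `SC·Ŵη₀` -/
  m0 : ℕ
  /-- `SC·Ŵη₁` -/
  m1 : ℕ
  /-- `SC·Ŵη₂` -/
  m2 : ℕ

/-- `SC³ = 2¹⁴⁴` (the per-label quantities `‖P‖²`, `2Σ|P_a|D_a + ΣD_a²` live at scale `SC⁴` and are brought back to scale `SC`). -/
def SC3N : ℕ := 22300745198530623141535718272648361505980416

/-! ## §2. The accumulator -/

/-- Fold state: hand-2's `AccH` (values, derivative terms, `Σδ`, ten signed gradient classes, curvature) plus `sa = Σ_treated aD` and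
`sr = Σ_treated R`. -/
structure AccV where
  /-- no range / lookup failure so far -/
  ok : Bool
  /-- `Σ V⁺` -/
  vP : ℕ
  /-- `Σ V⁻` -/
  vN : ℕ
  /-- `Σ (D δ)⁺` -/
  dP : ℕ
  /-- `Σ (D δ)⁻` -/
  dN : ℕ
  /-- `Σ δ` -/
  sd : ℕ
  /-- gradient class `b₀²`, `+` -/
  g0P : ℕ
  /-- class `b₀²`, `−` -/
  g0N : ℕ
  /-- class `b₁²` -/
  g1P : ℕ
  /-- class `b₁²` -/
  g1N : ℕ
  /-- class `b₂²` -/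
  g2P : ℕ
  /-- class `b₂²` -/
  g2N : ℕ
  /-- class `b₀b₁` -/
  g3P : ℕ
  /-- class `b₀b₁` -/
  g3N : ℕ
  /-- class `b₀b₂` -/
  g4P : ℕ
  /-- class `b₀b₂` -/
  g4N : ℕ
  /-- class `b₁b₂` -/
  g5P : ℕ
  /-- class `b₁b₂` -/
  g5N : ℕ
  /-- class `2ub₀` -/
  g6P : ℕ
  /-- class `2ub₀` -/
  g6N : ℕ
  /-- class `2ub₁` -/
  g7P : ℕ
  /-- class `2ub₁` -/
  g7N : ℕ
  /-- class `2ub₂` -/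
  g8P : ℕ
  /-- class `2ub₂` -/
  g8N : ℕ
  /-- class `u` -/
  g9P : ℕ
  /-- class `u` -/
  g9N : ℕ
  /-- `Σ M (δ + R)²` -/
  cur : ℕ
  /-- `Σ_treated |D̂| = Σ aD` -/
  sa : ℕ
  /-- `Σ_treated R` -/
  sr : ℕ

/-- The empty accumulator. -/
def accV0 : AccV := ⟨true, 0, 0, 0, 0, 0, 0, 0, 0, 0, 0, 0, 0, 0, 0, 0, 0, 0, 0, 0, 0, 0, 0, 0, 0, 0, 0, 0, 0⟩

/-- Mark failure (fields kept). -/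
def AccV.fail (a : AccV) : AccV :=
  ⟨false, a.vP, a.vN, a.dP, a.dN, a.sd, a.g0P, a.g0N, a.g1P, a.g1N, a.g2P, a.g2N, a.g3P, a.g3N, a.g4P, a.g4N, a.g5P, a.g5N,
   a.g6P, a.g6N, a.g7P, a.g7N, a.g8P, a.g8N, a.g9P, a.g9N, a.cur, a.sa, a.sr⟩

/-! ## §3. Per-label integers: scaled-frame vector, centre value, deviation bound, radius -/

/-- `e₀ = 2b₀ + b₁ + u`. -/
def e0 (l : NH) : ℤ := Int.add (Int.add (Int.mul 2 l.b0) l.b1) (l.u : ℤ)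

/-- `e₁ = 3b₁ + u`. -/
def e1 (l : NH) : ℤ := Int.add (Int.mul 3 l.b1) (l.u : ℤ)

/-- `e₂ = 2b₂ + u`. -/
def e2 (l : NH) : ℤ := Int.add (Int.mul 2 l.b2) (l.u : ℤ)

/-- `Z₀ = SC·e₀ + u·η̂₀` (scale `SC`). -/
def Z0 (k : LV) (l : NH) : ℤ := Int.add (Int.mul (SCN : ℤ) (e0 l)) (Int.mul (l.u : ℤ) k.n0)

/-- `Z₁ = SC·e₁ + u·η̂₁`. -/
def Z1 (k : LV) (l : NH) : ℤ := Int.add (Int.mul (SCN : ℤ) (e1 l)) (Int.mul (l.u : ℤ) k.n1)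

/-- `Z₂ = SC·e₂ + u·η̂₂`. -/
def Z2 (k : LV) (l : NH) : ℤ := Int.add (Int.mul (SCN : ℤ) (e2 l)) (Int.mul (l.u : ℤ) k.n2)

/-- `P₀ = Σ_c V̂₀c Z_c` (scale `SC²`). -/
def P0 (k : LV) (l : NH) : ℤ := Int.add (Int.add (Int.mul k.v00 (Z0 k l)) (Int.mul k.v01 (Z1 k l))) (Int.mul k.v02 (Z2 k l))

/-- `P₁ = Σ_c V̂₁c Z_c`. -/
def P1 (k : LV) (l : NH) : ℤ := Int.add (Int.add (Int.mul k.v10 (Z0 k l)) (Int.mul k.v11 (Z1 k l))) (Int.mul k.v12 (Z2 k l))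

/-- `P₂ = Σ_c V̂₂c Z_c`. -/
def P2 (k : LV) (l : NH) : ℤ := Int.add (Int.add (Int.mul k.v20 (Z0 k l)) (Int.mul k.v21 (Z1 k l))) (Int.mul k.v22 (Z2 k l))

/-- `‖P‖²` (scale `SC⁴`). -/
def QQ (k : LV) (l : NH) : ℕ :=
  Nat.add (Nat.add (Nat.mul (P0 k l).natAbs (P0 k l).natAbs) (Nat.mul (P1 k l).natAbs (P1 k l).natAbs)) (Nat.mul (P2 k l).natAbs (P2 k l).natAbs)

/-- ★ The label's centre value `Q = ⌊‖P‖² / SC³⌋` (scale `SC`). -/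
def QV (k : LV) (l : NH) : ℕ := Nat.div (QQ k l) SC3N

/-- Shuffle part of the deviation bound (shifted family only): `Σ_c |V̂_ac| Ŵη_c + Σ_c Ŵ_ac Ŵη_c` for row `a` given as its six data. -/
def shufD (va0 va1 va2 : ℤ) (wa0 wa1 wa2 : ℕ) (k : LV) : ℕ :=
  Nat.add (Nat.add (Nat.add (Nat.mul va0.natAbs k.m0) (Nat.mul va1.natAbs k.m1)) (Nat.mul va2.natAbs k.m2))
    (Nat.add (Nat.add (Nat.mul wa0 k.m0) (Nat.mul wa1 k.m1)) (Nat.mul wa2 k.m2))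

/-- `D₀ = Σ_c Ŵ₀c |Z_c| + u·shufD₀` (scale `SC²`). -/
def DD0 (k : LV) (l : NH) : ℕ :=
  Nat.add (Nat.add (Nat.add (Nat.mul k.w00 (Z0 k l).natAbs) (Nat.mul k.w01 (Z1 k l).natAbs)) (Nat.mul k.w02 (Z2 k l).natAbs))
    (Nat.mul l.u (shufD k.v00 k.v01 k.v02 k.w00 k.w01 k.w02 k))

/-- `D₁`. -/
def DD1 (k : LV) (l : NH) : ℕ :=
  Nat.add (Nat.add (Nat.add (Nat.mul k.w10 (Z0 k l).natAbs) (Nat.mul k.w11 (Z1 k l).natAbs)) (Nat.mul k.w12 (Z2 k l).natAbs))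
    (Nat.mul l.u (shufD k.v10 k.v11 k.v12 k.w10 k.w11 k.w12 k))

/-- `D₂`. -/
def DD2 (k : LV) (l : NH) : ℕ :=
  Nat.add (Nat.add (Nat.add (Nat.mul k.w20 (Z0 k l).natAbs) (Nat.mul k.w21 (Z1 k l).natAbs)) (Nat.mul k.w22 (Z2 k l).natAbs))
    (Nat.mul l.u (shufD k.v20 k.v21 k.v22 k.w20 k.w21 k.w22 k))

/-- `2 Σ_a |P_a| D_a + Σ_a D_a²` (scale `SC⁴`): `SC⁴`× a bound of `|‖V z‖² − ‖V̂ z⁰‖²|` over the box. -/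
def RR (k : LV) (l : NH) : ℕ :=
  Nat.add (Nat.mul 2 (Nat.add (Nat.add (Nat.mul (P0 k l).natAbs (DD0 k l)) (Nat.mul (P1 k l).natAbs (DD1 k l))) (Nat.mul (P2 k l).natAbs (DD2 k l))))
    (Nat.add (Nat.add (Nat.mul (DD0 k l) (DD0 k l)) (Nat.mul (DD1 k l) (DD1 k l))) (Nat.mul (DD2 k l) (DD2 k l)))

/-- ★ The label's range radius `R = ⌊RR / SC³⌋ + 2` (scale `SC`; the `+2` covers the two floorings). -/
def RV (k : LV) (l : NH) : ℕ := Nat.add (Nat.div (RR k l) SC3N) 2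

/-! ## §4. The per-label step and the fold -/

/-- Step 4: accumulate the row's data for this label (`δ = Q − t ≥ 0`, `r` the radius): hand-2's `step4H` fields, plus `sa += aD`, `sr += r`. -/
def step4V (a : AccV) (l : NH) (r : ℕ) (row : Row) (δ : ℕ) : AccV :=
  ⟨a.ok, addP row.sV row.aV a.vP, addN row.sV row.aV a.vN,
   addP row.sD (Nat.mul row.aD δ) a.dP, addN row.sD (Nat.mul row.aD δ) a.dN, Nat.add a.sd δ,
   addP row.sD (Nat.mul row.aD l.m00) a.g0P, addN row.sD (Nat.mul row.aD l.m00) a.g0N,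
   addP row.sD (Nat.mul row.aD l.m11) a.g1P, addN row.sD (Nat.mul row.aD l.m11) a.g1N,
   addP row.sD (Nat.mul row.aD l.m22) a.g2P, addN row.sD (Nat.mul row.aD l.m22) a.g2N,
   addP (sx row.sD l.s01) (Nat.mul row.aD l.m01) a.g3P, addN (sx row.sD l.s01) (Nat.mul row.aD l.m01) a.g3N,
   addP (sx row.sD l.s02) (Nat.mul row.aD l.m02) a.g4P, addN (sx row.sD l.s02) (Nat.mul row.aD l.m02) a.g4N,
   addP (sx row.sD l.s12) (Nat.mul row.aD l.m12) a.g5P, addN (sx row.sD l.s12) (Nat.mul row.aD l.m12) a.g5N,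
   addP (sx row.sD l.z0) (Nat.mul row.aD l.a0) a.g6P, addN (sx row.sD l.z0) (Nat.mul row.aD l.a0) a.g6N,
   addP (sx row.sD l.z1) (Nat.mul row.aD l.a1) a.g7P, addN (sx row.sD l.z1) (Nat.mul row.aD l.a1) a.g7N,
   addP (sx row.sD l.z2) (Nat.mul row.aD l.a2) a.g8P, addN (sx row.sD l.z2) (Nat.mul row.aD l.a2) a.g8N,
   addP row.sD (Nat.mul row.aD l.u) a.g9P, addN row.sD (Nat.mul row.aD l.u) a.g9N,
   Nat.add a.cur (Nat.mul row.M (Nat.mul (Nat.add δ r) (Nat.add δ r))), Nat.add a.sa row.aD, Nat.add a.sr r⟩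

/-- Step 3: the looked-up row must cover `[Q − r, Q + r]` and lie left of `Q`. -/
def step3V (a : AccV) (l : NH) (q r : ℕ) : Option Row → AccV
  | none => a.fail
  | some row =>
    match Nat.ble row.A (Nat.sub q r) && Nat.ble (Nat.add q r) row.B && Nat.ble row.t q with
    | true => step4V a l r row (Nat.sub q row.t)
    | false => a.fail

/-- Step 2: a label whose whole range lies beyond `81/4` is FAR for this box (contributes `0`); otherwise look it up. -/
def step2V (tab : QT) (a : AccV) (l : NH) (q r : ℕ) : AccV :=
  match Nat.ble (Nat.mul 81 SCN) (Nat.mul 4 (Nat.sub q r)) with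
  | true => a
  | false => step3V a l q r (QT.findLE q tab none)

/-- Step 1: the radius must not exceed the centre value. -/
def step1V (tab : QT) (a : AccV) (l : NH) (q r : ℕ) : AccV :=
  match Nat.ble r q with
  | true => step2V tab a l q r
  | false => a.fail

/-- The per-label step of the vector-form leaf. -/
def stepV (tab : QT) (k : LV) (a : AccV) (l : NH) : AccV :=
  step1V tab a l (QV k l) (RV k l)

/-- The fold over the near-label list (both families; no stop norm). -/
def foldV (tab : QT) (k : LV) : AccV → List NH → AccV
  | a, [] => a
  | a, l :: ls => foldV tab k (stepV tab k a l) ls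

/-! ## §5. The moments `2Γ`, `2γ`, `2C` from the class gradients, and the penalty -/

/-- Signed class gradient `gP − gN`. -/
def gV (P N : ℕ) : ℤ := Int.subNatNat P N

/-- `2A₀₀ = 2Σ D̂ e₀² = 8g₀ + 2g₁ + 8g₃ + 4g₆ + 2g₇ + 2g₉` (scale `SC`). -/
def A00 (a : AccV) : ℤ :=
  Int.add (Int.add (Int.add (Int.add (Int.add (Int.mul 8 (gV a.g0P a.g0N)) (Int.mul 2 (gV a.g1P a.g1N))) (Int.mul 8 (gV a.g3P a.g3N)))
    (Int.mul 4 (gV a.g6P a.g6N))) (Int.mul 2 (gV a.g7P a.g7N))) (Int.mul 2 (gV a.g9P a.g9N))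

/-- `2A₁₁ = 18g₁ + 6g₇ + 2g₉`. -/
def A11 (a : AccV) : ℤ := Int.add (Int.add (Int.mul 18 (gV a.g1P a.g1N)) (Int.mul 6 (gV a.g7P a.g7N))) (Int.mul 2 (gV a.g9P a.g9N))

/-- `2A₂₂ = 8g₂ + 4g₈ + 2g₉`. -/
def A22 (a : AccV) : ℤ := Int.add (Int.add (Int.mul 8 (gV a.g2P a.g2N)) (Int.mul 4 (gV a.g8P a.g8N))) (Int.mul 2 (gV a.g9P a.g9N))

/-- `2A₀₁ = 6g₁ + 12g₃ + 2g₆ + 4g₇ + 2g₉`. -/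
def A01 (a : AccV) : ℤ :=
  Int.add (Int.add (Int.add (Int.add (Int.mul 6 (gV a.g1P a.g1N)) (Int.mul 12 (gV a.g3P a.g3N))) (Int.mul 2 (gV a.g6P a.g6N)))
    (Int.mul 4 (gV a.g7P a.g7N))) (Int.mul 2 (gV a.g9P a.g9N))

/-- `2A₀₂ = 8g₄ + 4g₅ + 2g₆ + g₇ + 2g₈ + 2g₉`. -/
def A02 (a : AccV) : ℤ :=
  Int.add (Int.add (Int.add (Int.add (Int.add (Int.mul 8 (gV a.g4P a.g4N)) (Int.mul 4 (gV a.g5P a.g5N))) (Int.mul 2 (gV a.g6P a.g6N)))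
    (gV a.g7P a.g7N)) (Int.mul 2 (gV a.g8P a.g8N))) (Int.mul 2 (gV a.g9P a.g9N))

/-- `2A₁₂ = 12g₅ + 3g₇ + 2g₈ + 2g₉`. -/
def A12 (a : AccV) : ℤ :=
  Int.add (Int.add (Int.add (Int.mul 12 (gV a.g5P a.g5N)) (Int.mul 3 (gV a.g7P a.g7N))) (Int.mul 2 (gV a.g8P a.g8N))) (Int.mul 2 (gV a.g9P a.g9N))

/-- `2B₀ = 2Σ D̂ u e₀ = 2g₆ + g₇ + 2g₉`. -/
def B0 (a : AccV) : ℤ := Int.add (Int.add (Int.mul 2 (gV a.g6P a.g6N)) (gV a.g7P a.g7N)) (Int.mul 2 (gV a.g9P a.g9N))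

/-- `2B₁ = 3g₇ + 2g₉`. -/
def B1 (a : AccV) : ℤ := Int.add (Int.mul 3 (gV a.g7P a.g7N)) (Int.mul 2 (gV a.g9P a.g9N))

/-- `2B₂ = 2g₈ + 2g₉`. -/
def B2 (a : AccV) : ℤ := Int.add (Int.mul 2 (gV a.g8P a.g8N)) (Int.mul 2 (gV a.g9P a.g9N))

/-- `2C = 2g₉`. -/
def C2 (a : AccV) : ℤ := Int.mul 2 (gV a.g9P a.g9N)

/-- `SC³·2Γ_cc' = SC²·2A_cc' + SC·(η̂_c'·2B_c + η̂_c·2B_c') + η̂_c η̂_c'·2C` from its four data. -/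
def GGof (A Bc Bc' nc nc' C : ℤ) : ℤ :=
  Int.add (Int.add (Int.mul (Int.mul (SCN : ℤ) (SCN : ℤ)) A) (Int.mul (SCN : ℤ) (Int.add (Int.mul nc' Bc) (Int.mul nc Bc')))) (Int.mul (Int.mul nc nc') C)

/-- `SC²·2γ_c = SC·2B_c + η̂_c·2C`. -/
def ggof (Bc nc C : ℤ) : ℤ := Int.add (Int.mul (SCN : ℤ) Bc) (Int.mul nc C)

/-- `|x·a + y·b + z·c|`. -/
def adot (x y z a b c : ℤ) : ℕ := (Int.add (Int.add (Int.mul x a) (Int.mul y b)) (Int.mul z c)).natAbs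

/-- The penalty numerator `T1 + … + T6` (scale `SC⁵`) from the moments `GG` (six), `gg` (three), `CC` and the leaf data. -/
def penV (k : LV) (G00 G11 G22 G01 G02 G12 g0 g1 g2 CC : ℤ) : ℕ :=
  -- T1 = Σ_{a,c} |Σ_c' v_ac' GG_c'c| w_ac
  let T1 : ℕ :=
    Nat.add (Nat.add
      (Nat.add (Nat.add (Nat.mul (adot k.v00 k.v01 k.v02 G00 G01 G02) k.w00) (Nat.mul (adot k.v00 k.v01 k.v02 G01 G11 G12) k.w01))
        (Nat.mul (adot k.v00 k.v01 k.v02 G02 G12 G22) k.w02))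
      (Nat.add (Nat.add (Nat.mul (adot k.v10 k.v11 k.v12 G00 G01 G02) k.w10) (Nat.mul (adot k.v10 k.v11 k.v12 G01 G11 G12) k.w11))
        (Nat.mul (adot k.v10 k.v11 k.v12 G02 G12 G22) k.w12)))
      (Nat.add (Nat.add (Nat.mul (adot k.v20 k.v21 k.v22 G00 G01 G02) k.w20) (Nat.mul (adot k.v20 k.v21 k.v22 G01 G11 G12) k.w21))
        (Nat.mul (adot k.v20 k.v21 k.v22 G02 G12 G22) k.w22))
  -- M = V̂ᵀV̂ (scale SC²)
  let M00 : ℤ := Int.add (Int.add (Int.mul k.v00 k.v00) (Int.mul k.v10 k.v10)) (Int.mul k.v20 k.v20)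
  let M11 : ℤ := Int.add (Int.add (Int.mul k.v01 k.v01) (Int.mul k.v11 k.v11)) (Int.mul k.v21 k.v21)
  let M22 : ℤ := Int.add (Int.add (Int.mul k.v02 k.v02) (Int.mul k.v12 k.v12)) (Int.mul k.v22 k.v22)
  let M01 : ℤ := Int.add (Int.add (Int.mul k.v00 k.v01) (Int.mul k.v10 k.v11)) (Int.mul k.v20 k.v21)
  let M02 : ℤ := Int.add (Int.add (Int.mul k.v00 k.v02) (Int.mul k.v10 k.v12)) (Int.mul k.v20 k.v22)
  let M12 : ℤ := Int.add (Int.add (Int.mul k.v01 k.v02) (Int.mul k.v11 k.v12)) (Int.mul k.v21 k.v22)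
  -- T2 = Σ_c |Σ_c'' M_cc'' gg_c''| m_c
  let T2 : ℕ := Nat.add (Nat.add (Nat.mul (adot M00 M01 M02 g0 g1 g2) k.m0) (Nat.mul (adot M01 M11 M12 g0 g1 g2) k.m1))
    (Nat.mul (adot M02 M12 M22 g0 g1 g2) k.m2)
  -- XX_a = Σ_c w_ac m_c ; T3 = Σ_a |Σ_c v_ac gg_c| XX_a
  let X0 : ℕ := Nat.add (Nat.add (Nat.mul k.w00 k.m0) (Nat.mul k.w01 k.m1)) (Nat.mul k.w02 k.m2)
  let X1 : ℕ := Nat.add (Nat.add (Nat.mul k.w10 k.m0) (Nat.mul k.w11 k.m1)) (Nat.mul k.w12 k.m2)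
  let X2 : ℕ := Nat.add (Nat.add (Nat.mul k.w20 k.m0) (Nat.mul k.w21 k.m1)) (Nat.mul k.w22 k.m2)
  let T3 : ℕ := Nat.add (Nat.add (Nat.mul (adot k.v00 k.v01 k.v02 g0 g1 g2) X0) (Nat.mul (adot k.v10 k.v11 k.v12 g0 g1 g2) X1))
    (Nat.mul (adot k.v20 k.v21 k.v22 g0 g1 g2) X2)
  -- T4 = Σ_a Σ_{c,c'} w_ac w_ac' |GG_cc'|
  let a00 : ℕ := G00.natAbs
  let a11 : ℕ := G11.natAbs
  let a22 : ℕ := G22.natAbs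
  let a01 : ℕ := G01.natAbs
  let a02 : ℕ := G02.natAbs
  let a12 : ℕ := G12.natAbs
  let row4 : ℕ → ℕ → ℕ → ℕ := fun x y z =>
    Nat.add (Nat.add (Nat.mul x (Nat.add (Nat.add (Nat.mul x a00) (Nat.mul y a01)) (Nat.mul z a02)))
      (Nat.mul y (Nat.add (Nat.add (Nat.mul x a01) (Nat.mul y a11)) (Nat.mul z a12))))
      (Nat.mul z (Nat.add (Nat.add (Nat.mul x a02) (Nat.mul y a12)) (Nat.mul z a22)))
  let T4 : ℕ := Nat.add (Nat.add (row4 k.w00 k.w01 k.w02) (row4 k.w10 k.w11 k.w12)) (row4 k.w20 k.w21 k.w22)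
  -- YY_a = Σ_c (|v_ac| + w_ac) m_c ; T5 = Σ_a (Σ_c w_ac |gg_c|) YY_a ; T6 = |CC| Σ_a YY_a²
  let Y0 : ℕ := Nat.add (Nat.add (Nat.mul (Nat.add k.v00.natAbs k.w00) k.m0) (Nat.mul (Nat.add k.v01.natAbs k.w01) k.m1))
    (Nat.mul (Nat.add k.v02.natAbs k.w02) k.m2)
  let Y1 : ℕ := Nat.add (Nat.add (Nat.mul (Nat.add k.v10.natAbs k.w10) k.m0) (Nat.mul (Nat.add k.v11.natAbs k.w11) k.m1))
    (Nat.mul (Nat.add k.v12.natAbs k.w12) k.m2)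
  let Y2 : ℕ := Nat.add (Nat.add (Nat.mul (Nat.add k.v20.natAbs k.w20) k.m0) (Nat.mul (Nat.add k.v21.natAbs k.w21) k.m1))
    (Nat.mul (Nat.add k.v22.natAbs k.w22) k.m2)
  let b0 : ℕ := g0.natAbs
  let b1 : ℕ := g1.natAbs
  let b2 : ℕ := g2.natAbs
  let T5 : ℕ := Nat.add (Nat.add (Nat.mul (Nat.add (Nat.add (Nat.mul k.w00 b0) (Nat.mul k.w01 b1)) (Nat.mul k.w02 b2)) Y0)
    (Nat.mul (Nat.add (Nat.add (Nat.mul k.w10 b0) (Nat.mul k.w11 b1)) (Nat.mul k.w12 b2)) Y1))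
    (Nat.mul (Nat.add (Nat.add (Nat.mul k.w20 b0) (Nat.mul k.w21 b1)) (Nat.mul k.w22 b2)) Y2)
  let T6 : ℕ := Nat.mul CC.natAbs (Nat.add (Nat.add (Nat.mul Y0 Y0) (Nat.mul Y1 Y1)) (Nat.mul Y2 Y2))
  Nat.add (Nat.add (Nat.add (Nat.add (Nat.add T1 T2) T3) T4) T5) T6

/-- ★ The first+second-order penalty `G = ⌊(T1 + … + T6)/SC³⌋ + 1` (scale `SC²`) of the accumulator's class gradients on the leaf `k`. -/
def GV (k : LV) (a : AccV) : ℕ :=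
  let c : ℤ := C2 a
  let b0 : ℤ := B0 a
  let b1 : ℤ := B1 a
  let b2 : ℤ := B2 a
  Nat.add (Nat.div
    (penV k (GGof (A00 a) b0 b0 k.n0 k.n0 c) (GGof (A11 a) b1 b1 k.n1 k.n1 c) (GGof (A22 a) b2 b2 k.n2 k.n2 c)
      (GGof (A01 a) b0 b1 k.n0 k.n1 c) (GGof (A02 a) b0 b2 k.n0 k.n2 c) (GGof (A12 a) b1 b2 k.n1 k.n2 c)
      (ggof b0 k.n0 c) (ggof b1 k.n1 c) (ggof b2 k.n2 c) c)
    SC3N) 1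

/-! ## §6. The final inequality (× `SC³`) and the leaf check -/

/-- Left side: `μ⁺SC² + 2(SC²·vN + SC·dN + SC·E·Σδ + SC·sa + SC·E·sr + SC·G) + cur`. -/
def lhsV (E : ℕ) (μP G : ℕ) (a : AccV) : ℕ :=
  Nat.add (Nat.add (Nat.mul μP (Nat.mul SCN SCN))
    (Nat.mul 2 (Nat.add (Nat.add (Nat.add (Nat.add (Nat.add (Nat.mul (Nat.mul SCN SCN) a.vN) (Nat.mul SCN a.dN)) (Nat.mul (Nat.mul SCN E) a.sd))
      (Nat.mul SCN a.sa)) (Nat.mul (Nat.mul SCN E) a.sr)) (Nat.mul SCN G)))) a.cur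

/-- Right side: `μ⁻SC² + 2(SC²·vP + SC·dP)`. -/
def rhsV (μN : ℕ) (a : AccV) : ℕ :=
  Nat.add (Nat.mul μN (Nat.mul SCN SCN)) (Nat.mul 2 (Nat.add (Nat.mul (Nat.mul SCN SCN) a.vP) (Nat.mul SCN a.dP)))

/-- Final verdict from the accumulator. -/
def finalV (E : ℕ) (k : LV) (sμ : Bool) (aμ : ℕ) (a : AccV) : Bool :=
  a.ok && Nat.ble (lhsV E (addP sμ aμ 0) (GV k a) a) (rhsV (addN sμ aμ 0) a)

/-- ★★ **THE hcp VECTOR-FORM LEAF CHECK**: table `tab` (certified once), near-label list `labs` of both families (hand-2's `nearLabelsH`), derivative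
half-width `E`, the scaled-frame box `k`, the target `∓aμ` (sign bit `sμ`; the entry module passes the doubled target as for `leafCheckH`). -/
def leafCheckV (tab : QT) (labs : List NH) (E : ℕ) (k : LV) (sμ : Bool) (aμ : ℕ) : Bool :=
  finalV E k sμ aμ (foldV tab k accV0 labs)

end Summit.AtomisticToContinuum.Crystallization.Theorems.FrustratedLawDichotomyStrainedPatchHomLeafTableCheckHcpV
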